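import Literature.NumberTheory.EllipticCurves.GreenbergVatsal2000.CharacterPAdicLFunctionExistenceProofs
import Literature.NumberTheory.EllipticCurves.PAdicPowerSeriesZeros
import HarnessLib

/-!
# Greenberg–Vatsal 2000, §3 pp. 41–42: `L_{Σ₀}(C, T)` and `L_{Σ₀}(D, T)` are CHARACTERIZED by their
# interpolation property — uniqueness, and `∃!` forms of the Kubota–Leopoldt–Iwasawa existence

HONEST FRAMING (BSD rank-`≤ 1` residual cell `b2b-bsdres`, home
`run/shared/lean/b2b/bsd-rank1-residual/`, unit `b2b-bsdres-eisenstein-p2`, class X2, gen 25): the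
cell deletes the COMBINATION-SHAPED residual classes of the rank-`≤ 1` BSD formula from PUBLISHED
theorems only and TYPES the construction-shaped ones; this is not "finishing BSD". This file proves,
about the tree's DEFINITIONS `IsCharacterLFunctionC p φ Σ₀ g` / `IsCharacterLFunctionD p ψ Σ₀ g`
(`CharacterPAdicLFunctions.lean`: "`g ∈ Λ` takes the Kubota–Leopoldt values at the points
`T = κ(γ)^{±(k−1)} − 1`, `k ≥ 1`"), the sentence of Greenberg–Vatsal by which those predicates were
justified as DEFINITIONS of `L_{Σ₀}(C, T)`, `L_{Σ₀}(D, T)`: p. 41 "The `p`-adic `L`-function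
`L(C, χ, T) ∈ Λ` is **characterized** by the interpolation property", p. 42 likewise for `D`, with
p. 4 "a nonzero element of `Λ ⊗ ℚ_p` has only finitely many zeros in the open unit disc". That is:
AT MOST ONE `g ∈ Λ` satisfies each predicate (`IsCharacterLFunctionC.unique`,
`IsCharacterLFunctionD.unique`), so that — with the Kubota–Leopoldt–Iwasawa EXISTENCE proved in
`CharacterPAdicLFunctionExistenceProofs.lean` (`exists_isCharacterLFunctionC/D`, the cell's fact
F0 = A223 `exists_characterLFunction`, a theorem since gen 23) — the predicates single out exactly
one element of `Λ` each (`existsUnique_isCharacterLFunctionC/D`): the tree's `L_{Σ₀}(C, T)` and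
`L_{Σ₀}(D, T)` ARE well-defined elements of `Λ`, and every statement the cell registered "for all
`g` with `IsCharacterLFunctionC p φ Σ₀ g`" (facts F1–F3: `EisensteinCongruence.lean`,
`CharacterInvariants.lean`) is a statement about that one element. (Referee-2 D-audit carry
"`IsCharacterLFunctionC/D` interpolation = GV (26)/(27) at A223": the kernel half — the chosen
interpolation points DETERMINE the function — is this file; that the points are GV's relation
"`L_p(χωψ⁻¹, s) = L(C, χ, κ(γ)^{−s} − 1)` for all `s ∈ ℤ_p`" read at `s = 1 − k` is the docstring
of the definitions.)

The principle (`IwasawaAlgebra.eq_zero_of_forall_hasSum_zero`, `…eq_of_forall_hasSum_eq`): an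
element of `Λ = ℤ_p⟦T⟧` whose `ℚ_p`-evaluations vanish at infinitely many (pairwise distinct)
points of the open unit disc of `ℚ_p` is zero — by the finiteness of the zeros of a nonzero
element of `Λ ⊗ ℚ_p` in the open unit disc of `ℂ_p` (`p`-adic Weierstrass preparation; the tree's
`MemIwasawaRat.finite_setOf_hasSum_zero`, `PAdicPowerSeriesZeros.lean`), after embedding
`ℚ_p ↪ ℂ_p`. The interpolation points `κ(γ)^{k−1} − 1` (`k ≥ 1`), resp. `κ(γ)^{1−k} − 1`, are
pairwise distinct elements of `pℤ_p` because `κ(γ) = cyclotomicGenerator p = 1 + p^{e₀} > 1` is a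
natural number (`cyclotomicGenerator_pow_injective`).

Everything is proved; there are no named facts and no new definitions.

## Citation header (held text `paper:arxiv-math_9906215`, dvips stream decoded by this lineage,
## `HOME/b2b-bsdres-eisenstein-p2/gv2000_decoded.gen21.txt`: p. 41 = p0064, p. 42 = p0065, p. 4)

* GV p. 41: "The `p`-adic `L`-function `L(C, χ, T) ∈ Λ` is characterized by the interpolation
  property `L(C, χ, ζ − 1) = L(C, χρ, 1) = L(χψ⁻¹ρ, 0)` (26) for every nontrivial character `ρ` of
  `Γ = Gal(ℚ_∞/ℚ)`. … `L(C, χ, T)` is related to the Kubota-Leopoldt `p`-adic `L`-function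
  `L_p(χωψ⁻¹, s)` by `L_p(χωψ⁻¹, s) = L(C, χ, κ(γ)^{−s} − 1)` for all `s ∈ ℤ_p`."
* GV p. 42: "The `p`-adic `L`-function `L(D, χ, T) ∈ Λ` is characterized by the interpolation
  property … (27) … `L(D, χ, T)` is related to the Kubota-Leopoldt `p`-adic `L`-function
  `L_p(ωχ⁻¹ψ⁻¹, s)` by `L_p(ωχ⁻¹ψ⁻¹, s) = ½ L(D, χ, κ(γ)^s − 1)` for all `s ∈ ℤ_p`."
* GV p. 4 (Introduction): a nonzero element of `Λ` has only finitely many zeros in the open unit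
  disc (so `L(E/ℚ_∞, χ, 1) ≠ 0` for all but finitely many `χ`); Lang, *Cyclotomic Fields I and
  II*, Ch. 5 §2 Thm. 2.2 (`p`-adic Weierstrass preparation, PDF p. 97).

References: [GreenbergVatsal2000] §1 p. 4, §3 pp. 41–42; [LangCyclotomic1990] Ch. 5 §2 Thm. 2.2;
Ch. 4 §1 Ex. 2 (the variable `T = γ^s − 1`).
-/

noncomputable section

open scoped Classical

open NumberField IsDedekindDomain

namespace Literature.NumberTheory.EllipticCurves

variable {p : ℕ} [Fact p.Prime]

/-! ## §1. An element of `Λ` is determined by its values at infinitely many points of `pℤ_p` -/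

/-- **An element of `Λ = ℤ_p⟦T⟧` vanishing at infinitely many points of the open unit disc of `ℚ_p`
is zero**: if `g(z_k) = ∑ₙ gₙ z_kⁿ = 0` in `ℚ_p` for a sequence of pairwise distinct `z_k` with
`|z_k| < 1`, then `g = 0`. Embed `ℚ_p ↪ ℂ_p`: the `z_k` become infinitely many zeros of
`g ∈ Λ ⊂ Λ ⊗ ℚ_p` in the open unit disc of `ℂ_p`, which for `g ≠ 0` are finite in number by the
`p`-adic Weierstrass preparation theorem (`MemIwasawaRat.finite_setOf_hasSum_zero`; GV p. 4;
Lang Ch. 5 §2 Thm. 2.2). [cite: LangCyclotomic1990, Ch. 5 §2 Thm. 2.2 (p-adic Weierstrass preparation, PDF p. 97)]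
[cite: GreenbergVatsal2000, §1 p. 4 (a nonzero element of Λ has finitely many zeros in the open unit disc)] -/
theorem IwasawaAlgebra.eq_zero_of_forall_hasSum_zero {g : IwasawaAlgebra p} {z : ℕ → ℚ_[p]}
    (hz : Function.Injective z) (hz1 : ∀ k, ‖z k‖ < 1)
    (h : ∀ k, HasSum (fun n ↦ ((PowerSeries.coeff n g : ℤ_[p]) : ℚ_[p]) * z k ^ n) 0) :
    g = 0 := by
  by_contra hg
  set ι : ℚ_[p] →+* ℂ_[p] := algebraMap ℚ_[p] ℂ_[p] with hι
  have hD0 : iwasawaToPowerSeries p g ≠ 0 := fun h0 ↦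
    hg (iwasawaToPowerSeries_injective p (by rw [h0, map_zero]))
  have hfin := MemIwasawaRat.finite_setOf_hasSum_zero (memIwasawaRat_iwasawaToPowerSeries p g) hD0
  -- the points `ι(z_k)` are zeros of `g` in the open unit disc of `ℂ_p`
  have hmem : ∀ k, ι (z k) ∈ {w : ℂ_[p] | ‖w‖ < 1 ∧
      HasSum (fun n ↦ algebraMap ℚ_[p] ℂ_[p]
        (PowerSeries.coeff n (iwasawaToPowerSeries p g)) * w ^ n) 0} := by
    intro k
    refine ⟨?_, ?_⟩
    · rw [hι, norm_algebraMap']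
      exact hz1 k
    · have hs := (h k).map ι (continuous_algebraMap ℚ_[p] ℂ_[p])
      rw [map_zero] at hs
      refine hs.congr_fun fun n ↦ ?_
      rw [Function.comp_apply, map_mul, map_pow, PowerSeries.coeff_map, PadicInt.algebraMap_apply]
  have hinj : Function.Injective fun k ↦ ι (z k) :=
    (algebraMap ℚ_[p] ℂ_[p]).injective.comp hz
  exact Set.infinite_of_injective_forall_mem hinj hmem hfin

/-- **Two elements of `Λ` with the same values at infinitely many points of the open unit disc of
`ℚ_p` are equal** (difference form of `IwasawaAlgebra.eq_zero_of_forall_hasSum_zero`; GV p. 41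
"characterized by the interpolation property"). [cite: GreenbergVatsal2000, §3 p. 41 (L(C,χ,T) characterized by interpolation) and §1 p. 4 (finitely many zeros)]
[cite: LangCyclotomic1990, Ch. 5 §2 Thm. 2.2 (PDF p. 97)] -/
theorem IwasawaAlgebra.eq_of_forall_hasSum_eq {g g' : IwasawaAlgebra p} {z : ℕ → ℚ_[p]}
    {v : ℕ → ℚ_[p]} (hz : Function.Injective z) (hz1 : ∀ k, ‖z k‖ < 1)
    (h : ∀ k, HasSum (fun n ↦ ((PowerSeries.coeff n g : ℤ_[p]) : ℚ_[p]) * z k ^ n) (v k))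
    (h' : ∀ k, HasSum (fun n ↦ ((PowerSeries.coeff n g' : ℤ_[p]) : ℚ_[p]) * z k ^ n) (v k)) :
    g = g' := by
  rw [← sub_eq_zero]
  refine IwasawaAlgebra.eq_zero_of_forall_hasSum_zero hz hz1 fun k ↦ ?_
  have hs := (h k).sub (h' k)
  rw [sub_self] at hs
  refine hs.congr_fun fun n ↦ ?_
  rw [map_sub, PadicInt.coe_sub, sub_mul]

/-! ## §2. The interpolation points `κ(γ)^{±(k−1)} − 1` are pairwise distinct -/

/-- `k ↦ κ(γ)^k` is injective in `ℚ_p`: `κ(γ) = 1 + p^{e₀} ≥ 2` is a natural number, so its powers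
are strictly increasing (Lang Ch. 4 §1 Ex. 2: `γ` topologically generates `1 + p^{e₀}ℤ_p`, of
infinite order). [cite: LangCyclotomic1990, Ch. 4 §1, Example 2 (the variable T = γ^s − 1, PDF p. 79)] -/
theorem cyclotomicGenerator_pow_injective :
    Function.Injective fun k : ℕ ↦ ((cyclotomicGenerator p : ℕ) : ℚ_[p]) ^ k := by
  intro k k' hkk'
  have h1 : 2 ≤ cyclotomicGenerator p := by
    unfold cyclotomicGenerator
    have := Nat.one_le_pow (cyclotomicExponent p) p (Fact.out : p.Prime).pos
    omega
  have hkk'' : ((cyclotomicGenerator p : ℕ) : ℚ_[p]) ^ k = ((cyclotomicGenerator p : ℕ) : ℚ_[p]) ^ k' :=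
    hkk'
  have hnat : (cyclotomicGenerator p) ^ k = (cyclotomicGenerator p) ^ k' := by
    exact_mod_cast hkk''
  exact Nat.pow_right_injective h1 hnat

/-- The points `κ(γ)^k − 1` (`k ≥ 0`) of `pℤ_p` are pairwise distinct. [cite: LangCyclotomic1990, Ch. 4 §1, Example 2 (PDF p. 79)] -/
theorem cyclotomicGenerator_pow_sub_one_injective :
    Function.Injective fun k : ℕ ↦ ((cyclotomicGenerator p : ℕ) : ℚ_[p]) ^ k - 1 :=
  fun _ _ h ↦ cyclotomicGenerator_pow_injective (sub_left_injective h)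

/-- The points `κ(γ)^{−k} − 1` (`k ≥ 0`) of `pℤ_p` are pairwise distinct. [cite: LangCyclotomic1990, Ch. 4 §1, Example 2 (PDF p. 79)] -/
theorem cyclotomicGenerator_inv_pow_sub_one_injective :
    Function.Injective fun k : ℕ ↦ (((cyclotomicGenerator p : ℕ) : ℚ_[p])⁻¹) ^ k - 1 := by
  intro k k' h
  have h2 : (((cyclotomicGenerator p : ℕ) : ℚ_[p])⁻¹) ^ k =
      (((cyclotomicGenerator p : ℕ) : ℚ_[p])⁻¹) ^ k' := sub_left_injective h
  rw [inv_pow, inv_pow, inv_inj] at h2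
  exact cyclotomicGenerator_pow_injective h2

namespace GreenbergVatsal2000

variable {m d : ℕ} (φ : DirichletCharacter (ZMod p) m) (ψ : DirichletCharacter (ZMod p) d)
  (S₀ : Finset (HeightOneSpectrum (𝓞 ℚ)))

/-! ## §3. `L_{Σ₀}(C, T)` and `L_{Σ₀}(D, T)` are characterized by their interpolation property -/

/-- **`L_{Σ₀}(C, T)` is characterized by its interpolation property** (GV p. 41 "The `p`-adic
`L`-function `L(C, χ, T) ∈ Λ` is characterized by the interpolation property … `L_p(χωψ⁻¹, s) =
L(C, χ, κ(γ)^{−s} − 1)` for all `s ∈ ℤ_p`"): two elements of `Λ` with the predicate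
`IsCharacterLFunctionC p φ Σ₀` — the Kubota–Leopoldt values `−(1/k)B_{k,φω^{−k}·1_{Σ₀}}` at the
infinitely many distinct points `κ(γ)^{k−1} − 1 ∈ pℤ_p`, `k ≥ 1` — are equal. No hypothesis on `p`,
`φ` or `Σ₀` is needed. [cite: GreenbergVatsal2000, §3 p. 41 (L(C,χ,T) ∈ Λ is characterized by the interpolation property; relation with L_p(χωψ⁻¹,s)) and §1 p. 4]
[cite: LangCyclotomic1990, Ch. 5 §2 Thm. 2.2 (PDF p. 97)] -/
theorem IsCharacterLFunctionC.unique {g g' : IwasawaAlgebra p} (hg : IsCharacterLFunctionC p φ S₀ g)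
    (hg' : IsCharacterLFunctionC p φ S₀ g') : g = g' :=
  IwasawaAlgebra.eq_of_forall_hasSum_eq (v := fun k ↦ characterLValueC p φ S₀ (k + 1))
    cyclotomicGenerator_pow_sub_one_injective (fun k ↦ norm_cyclotomicGenerator_pow_sub_one_lt k)
    (fun k ↦ by simpa only [Nat.add_sub_cancel] using hg (k + 1) (Nat.le_add_left 1 k))
    (fun k ↦ by simpa only [Nat.add_sub_cancel] using hg' (k + 1) (Nat.le_add_left 1 k))

/-- **`L_{Σ₀}(D, T)` is characterized by its interpolation property** (GV p. 42 "The `p`-adic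
`L`-function `L(D, χ, T) ∈ Λ` is characterized by the interpolation property … `L_p(ωχ⁻¹ψ⁻¹, s) =
½ L(D, χ, κ(γ)^s − 1)` for all `s ∈ ℤ_p`"): two elements of `Λ` with the predicate
`IsCharacterLFunctionD p ψ Σ₀` — prescribed values at the infinitely many distinct points
`κ(γ)^{1−k} − 1 ∈ pℤ_p`, `k ≥ 1` — are equal. [cite: GreenbergVatsal2000, §3 p. 42 (L(D,χ,T) ∈ Λ is characterized by the interpolation property; relation with L_p(ωχ⁻¹ψ⁻¹,s)) and §1 p. 4]
[cite: LangCyclotomic1990, Ch. 5 §2 Thm. 2.2 (PDF p. 97)] -/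
theorem IsCharacterLFunctionD.unique {g g' : IwasawaAlgebra p} (hg : IsCharacterLFunctionD p ψ S₀ g)
    (hg' : IsCharacterLFunctionD p ψ S₀ g') : g = g' :=
  IwasawaAlgebra.eq_of_forall_hasSum_eq (v := fun k ↦ characterLValueD p ψ S₀ (k + 1))
    cyclotomicGenerator_inv_pow_sub_one_injective
    (fun k ↦ norm_cyclotomicGenerator_inv_pow_sub_one_lt k)
    (fun k ↦ by simpa only [Nat.add_sub_cancel] using hg (k + 1) (Nat.le_add_left 1 k))
    (fun k ↦ by simpa only [Nat.add_sub_cancel] using hg' (k + 1) (Nat.le_add_left 1 k))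

/-- **Kubota–Leopoldt–Iwasawa, `∃!` form for `C`**: for an odd prime `p`, a primitive Dirichlet
character `φ` modulo `m` with `p ∣ m` (values in `𝔽_p`) and a finite set `Σ₀` of places, there is
EXACTLY ONE `g ∈ Λ` with `IsCharacterLFunctionC p φ Σ₀ g` — GV's `L_{Σ₀}(C, T)` (p. 41: "`L(C, χ,
T) ∈ Λ` is characterized by the interpolation property"; existence = Lang Ch. 4 §3 Thm. 3.2,
the tree's `exists_isCharacterLFunctionC`). [cite: GreenbergVatsal2000, §3 pp. 41–42 (L_{Σ₀}(C,χ,T) ∈ Λ characterized by interpolation)]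
[cite: LangCyclotomic1990, Ch. 4 §3 Thm. 3.2 (PDF p. 84) and Ch. 5 §2 Thm. 2.2 (PDF p. 97)] -/
theorem existsUnique_isCharacterLFunctionC [NeZero m] (hp : p ≠ 2) (hpm : p ∣ m)
    (hφ : φ.IsPrimitive) : ∃! g : IwasawaAlgebra p, IsCharacterLFunctionC p φ S₀ g := by
  obtain ⟨g, hg⟩ := exists_isCharacterLFunctionC p φ S₀ hp hpm hφ
  exact ⟨g, hg, fun g' hg' ↦ IsCharacterLFunctionC.unique φ S₀ hg' hg⟩

/-- **Kubota–Leopoldt–Iwasawa, `∃!` form for `D`**: for an odd prime `p`, a Dirichlet character `ψ`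
modulo `d` with `p ∤ d` (values in `𝔽_p`) and a finite set `Σ₀` of places not containing that of
`p`, there is EXACTLY ONE `g ∈ Λ` with `IsCharacterLFunctionD p ψ Σ₀ g` — GV's `L_{Σ₀}(D, T)` (p. 42:
"`L(D, χ, T) ∈ Λ` is characterized by the interpolation property"; existence = the tree's
`exists_isCharacterLFunctionD`). [cite: GreenbergVatsal2000, §3 p. 42 (L_{Σ₀}(D,χ,T) ∈ Λ characterized by interpolation)]
[cite: LangCyclotomic1990, Ch. 4 §3 Thm. 3.2 (PDF p. 84) and Ch. 5 §2 Thm. 2.2 (PDF p. 97)] -/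
theorem existsUnique_isCharacterLFunctionD [NeZero d] (hp : p ≠ 2) (hpd : ¬ p ∣ d)
    (hS : ∀ v ∈ S₀, ((p : ℕ) : 𝓞 ℚ) ∉ v.asIdeal) :
    ∃! g : IwasawaAlgebra p, IsCharacterLFunctionD p ψ S₀ g := by
  obtain ⟨g, hg⟩ := exists_isCharacterLFunctionD p ψ S₀ hp hpd hS
  exact ⟨g, hg, fun g' hg' ↦ IsCharacterLFunctionD.unique ψ S₀ hg' hg⟩

/-- **The named fact F0 = A223 in `∃!` form**: both clauses of `exists_characterLFunction` hold with
"there is exactly one" in place of "there is" — the predicates `IsCharacterLFunctionC/D` DEFINE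
GV's `L_{Σ₀}(C, T)`, `L_{Σ₀}(D, T)` as elements of `Λ` (pp. 41–42 "characterized by the
interpolation property"). [cite: GreenbergVatsal2000, §3 pp. 41–42 (L(C,χ,T), L(D,χ,T) ∈ Λ characterized by (26)/(27) and the Kubota–Leopoldt relations)]
[cite: LangCyclotomic1990, Ch. 4 §3 Thm. 3.2 and Ch. 5 §2 Thm. 2.2] -/
theorem existsUnique_characterLFunction :
    (∀ (p : ℕ) [Fact p.Prime] (m : ℕ) [NeZero m] (φ : DirichletCharacter (ZMod p) m)
        (S₀ : Finset (HeightOneSpectrum (𝓞 ℚ))),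
        p ≠ 2 → p ∣ m → φ.IsPrimitive → φ.Even →
        (∀ v ∈ S₀, ((p : ℕ) : 𝓞 ℚ) ∉ v.asIdeal) →
        ∃! g : IwasawaAlgebra p, IsCharacterLFunctionC p φ S₀ g) ∧
    (∀ (p : ℕ) [Fact p.Prime] (d : ℕ) [NeZero d] (ψ : DirichletCharacter (ZMod p) d)
        (S₀ : Finset (HeightOneSpectrum (𝓞 ℚ))),
        p ≠ 2 → ¬ p ∣ d → ψ.IsPrimitive → ψ.Odd →
        (∀ v ∈ S₀, ((p : ℕ) : 𝓞 ℚ) ∉ v.asIdeal) →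
        ∃! g : IwasawaAlgebra p, IsCharacterLFunctionD p ψ S₀ g) :=
  ⟨fun _p _ _m _ φ S₀ hp hpm hφ _ _ ↦ existsUnique_isCharacterLFunctionC φ S₀ hp hpm hφ,
    fun _p _ _d _ ψ S₀ hp hpd _ _ hS ↦ existsUnique_isCharacterLFunctionD ψ S₀ hp hpd hS⟩

end GreenbergVatsal2000

end Literature.NumberTheory.EllipticCurves

end
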